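import Literature.Probability.LatticeModels.ScaleFrameRatioJunk
import Literature.Probability.LatticeModels.BlockExplorationChainOff
import HarnessLib

/-!
# Kesten's ratio forgetting along a scale frame: one level of the chain, squeezed (proved)

Topic `Literature/Probability/LatticeModels` (trunk `StatMech`, family `crit-ising`). One level of
the multi-level chain of H. Kesten's ratio-limit scheme (PTRF 73 (1986), proof of Thm. 3,
eqs. (16)–(22)) in the planarity-free form of D. Basu, A. Sapozhnikov (ECP 22 (2017), §2,
eqs. (2.5)–(2.7)), on a `ScaleFrame` with inner block `(b, bM^m)` explored from `inSet b` and outer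
block `(b', b'M^m)`, `b' = bM^{m+17+g}`, explored from `inSet b'`; data are explored sets with their
rims wired OFF the inside; `φ` is the free random-cluster measure of the frame graph.

* `ScaleFrame.rad_bounds_of_touching_annSet`, `ScaleFrame.datumOff_iff_of_agree_far` — frame
  continuity: an edge touching the block `annSet b₀ (b₀M^m)` has good endpoints of radius
  `> b₀ - η`, so the off-wired datum event of the block is determined by the frame edges all of
  whose endpoints are good of radius `> b₀ - η`.
* `ScaleFrame.chainLevel_squeeze` — for an outer datum `(U_C, R_C)` and an anchor `y ∈ inSet b`,
  the clean one-step sum `S = Σ_d N(C, d) · u_y(d)` over the inner data `d = (U_d, R_d)`, with the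
  kernel `N(C, d) = φ(Fd_{b'}(C) ∩ Fd_b(d) ∩ {R_d ↔ R_C inside (U_C ∪ R_C) ∖ U_d})` and the
  conditional inside probabilities `u_y(d) = φ(Fd_b(d) ∩ InP_y(d)) / φ(Fd_b(d))`, squeezes the
  outer inside probability: `S ≤ φ(Fd_{b'}(C) ∩ InP_y(C))` and
  `(1 - (1-c)^{⌊m/2⌋}) φ(Fd_{b'}(C) ∩ InP_y(C)) ≤ S` — the chain identity
  `insidePiece_eq_sum_add_notWiredOff` (whose middle piece is the open crossing between the rims,
  `midPiece_iff_openCrossing`) plus the junk bound `ScaleFrame.inter_notWiredOff_le`.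

Everything is proved; no definitions.

## References
* [Kesten1986] H. Kesten, Probab. Theory Related Fields 73 (1986) 369–394, proof of Thm. 3.
* [BasuSapozhnikov2017ECP] D. Basu, A. Sapozhnikov, ECP 22 (2017) no. 26, §2, eqs. (2.5)–(2.7).
-/

open MeasureTheory Finset SimpleGraph
open Literature.Probability.Percolation (BondConfig openConnIn openCrossing explSet explRim explEvent)

namespace Literature.Probability.LatticeModels

variable {V : Type*} [Fintype V] [DecidableEq V]

namespace ScaleFrame

variable (F : ScaleFrame V)

/-- **Frame continuity at a block.** An edge of the frame touching the annulus `(s, s')`,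
`s' ≤ Rmax`, has all its endpoints good of radius in `(s - η, s' + η)`. [cite: Kesten1986, §2] -/
theorem rad_bounds_of_touching_annSet {s s' : ℝ} (hs' : s' ≤ F.Rmax) {e : Sym2 V} (he : e ∈ F.E)
    (hv : ∃ v ∈ e, v ∈ F.annSet s s') :
    ∀ x ∈ e, x ∈ F.good ∧ s - F.η < F.rad x ∧ F.rad x < s' + F.η := by
  obtain ⟨v, hve, hvg, hv1, hv2⟩ := hv
  intro x hx
  obtain ⟨hxg, hxr⟩ := F.adj_good e he v hve x hx hvg (by linarith)
  obtain ⟨h1, h2⟩ := abs_lt.1 hxr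
  exact ⟨hxg, by linarith, by linarith⟩

/-- Scales of a block: `b₀ + η ≤ b₀M^m` for `η ≤ b₀`, `M ≥ 4`, `m ≥ 1`. [folklore] -/
theorem base_add_eta_le {b₀ M : ℝ} {m : ℕ} (hb₀ : 0 < b₀) (hM : 4 ≤ M) (hm : 1 ≤ m)
    (hη : F.η ≤ b₀) : b₀ + F.η ≤ b₀ * M ^ m := by
  have h := scale_gap hb₀ hM (Nat.lt_of_lt_of_le Nat.zero_lt_one hm)
  rw [pow_zero, mul_one] at h
  linarith

/-- **(Det, far form) The off-wired datum event of the block `(b₀, b₀M^m)` is determined by the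
frame pairs all of whose endpoints are good of radius `> b₀ - η`** (they include every pair
touching the block, `rad_bounds_of_touching_annSet`; then `datumOff_iff_of_agree_on_block`).
[cite: BasuSapozhnikov2017ECP, §2, paragraph after eq. (2.3)] -/
theorem datumOff_iff_of_agree_far {b₀ M : ℝ} {m : ℕ} (hb₀ : 0 < b₀) (hM : 4 ≤ M) (hm : 1 ≤ m)
    (hη : F.η ≤ b₀) (hR : b₀ * M ^ m ≤ F.Rmax) {Eg : Set (Sym2 V)} (hEg : Eg ⊆ ↑F.E)
    {U R : Set V} {ω₁ ω₂ : BondConfig V}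
    (hag : ∀ e ∈ Eg, (∀ x ∈ e, x ∈ F.good ∧ b₀ - F.η < F.rad x) → (e ∈ ω₁ ↔ e ∈ ω₂)) :
    ω₁ ∩ Eg ∈ explEvent (F.inSet b₀) (F.annSet b₀ (b₀ * M ^ m)) U R ∩
        {ω | ∀ r ∈ R, ∀ r₂ ∈ R, ∃ v ∈ U \ F.inSet b₀, ∃ v' ∈ U \ F.inSet b₀,
          s(v, r) ∈ ω ∧ s(v', r₂) ∈ ω ∧ ω ∈ openConnIn (U \ F.inSet b₀) v v'} ↔
      ω₂ ∩ Eg ∈ explEvent (F.inSet b₀) (F.annSet b₀ (b₀ * M ^ m)) U R ∩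
        {ω | ∀ r ∈ R, ∀ r₂ ∈ R, ∃ v ∈ U \ F.inSet b₀, ∃ v' ∈ U \ F.inSet b₀,
          s(v, r) ∈ ω ∧ s(v', r₂) ∈ ω ∧ ω ∈ openConnIn (U \ F.inSet b₀) v v'} :=
  F.datumOff_iff_of_agree_on_block (F.base_add_eta_le hb₀ hM hm hη) hR hEg fun e he hv =>
    hag e he fun x hx =>
      let h := F.rad_bounds_of_touching_annSet hR (Finset.mem_coe.1 (hEg he)) hv x hx
      ⟨h.1, h.2.1⟩

/-- The inside piece `{y is joined inside U to a vertex carrying an open edge to R}` (read on the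
frame pairs) is increasing. [cite: BasuSapozhnikov2017ECP, §2 (eq. (2.4)–(2.6))] -/
theorem isUpperSet_insidePiece (y : V) (U R : Set V) :
    IsUpperSet {ω : BondConfig V | ∃ w ∈ R, ∃ v ∈ U,
      ω ∩ (↑F.E : Set (Sym2 V)) ∈ openConnIn U y v ∧ s(v, w) ∈ ω ∩ (↑F.E : Set (Sym2 V))} := by
  rintro ω₁ ω₂ hle ⟨w, hw, v, hv, h1, h2⟩
  exact ⟨w, hw, v, hv, Percolation.isUpperSet_openConnIn _ _ _
    (Set.inter_subset_inter_left _ hle) h1, hle h2.1, h2.2⟩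

/-! ### One level of the chain -/

/-- **One level of Kesten's chain, squeezed** (Kesten 1986, eqs. (16)–(22); Basu–Sapozhnikov 2017,
eqs. (2.5)–(2.7)). Inner block `(b, bM^m)` explored from `inSet b`, outer block `(b', b'M^m)` with
`b' = bM^{m+17+g}`, both data with rims wired off the inside, `φ` the free random-cluster measure
of (a graph equal to) the frame graph, `y ∈ inSet b`. For every outer datum `(U_C, R_C)` the clean
sum `S = Σ_d φ(Fd'(C) ∩ Fd(d) ∩ {R_d ↔ R_C in (U_C ∪ R_C) ∖ U_d}) · φ(Fd(d) ∩ InP_y(d)) / φ(Fd(d))`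
over all inner data satisfies `S ≤ φ(Fd'(C) ∩ InP_y(C))` and
`(1 - (1-c)^{⌊m/2⌋}) · φ(Fd'(C) ∩ InP_y(C)) ≤ S`: if `Fd'(C)` is empty everything vanishes;
otherwise `U_C ⊇ inSet b' ⊇ inSet b ∪ annSet b (bM^m)` and their neighbours, `R_C ∩ U_C = ∅`, and
`Fd'(C)` is read on the edges touching the outer block, so the chain identity
`insidePiece_eq_sum_add_notWiredOff` applies (its middle piece being the open crossing between
the rims on the two datum events, `midPiece_iff_openCrossing`), and its junk is at most
`(1-c)^{⌊m/2⌋} φ(Fd'(C) ∩ InP_y(C))` (`inter_notWiredOff_le`). [cite: Kesten1986, proof of Thm. 3, eqs. (16)–(22)] -/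
theorem chainLevel_squeeze (G : SimpleGraph V) [DecidableRel G.Adj]
    (hG : G = fromEdgeSet (↑F.E : Set (Sym2 V))) {p q c b b' M : ℝ} {m g : ℕ}
    (hp : p ∈ Set.Icc (0 : ℝ) 1) (hq : 1 ≤ q) (hc1 : c ≤ 1) (hb : 0 < b) (hM : 4 ≤ M) (hm : 1 ≤ m)
    (hb' : b' = b * M ^ (m + 17 + g)) (hRmax : b' * M ^ (m + 1) ≤ F.Rmax) (hη : F.η ≤ b)
    (hsep : ∀ i : ℕ, i + 1 ≤ m → F.SepBound p q c (b * M ^ i) (b * M ^ (i + 1)))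
    (UC RC : Set V) (y : V) (hy : y ∈ F.inSet b) :
    let P := rcMeasure G p q ∅
    let Fd : ℝ → Set V → Set V → Set (BondConfig V) := fun b₀ U R =>
      {ω | ω ∩ (↑F.E : Set (Sym2 V)) ∈ explEvent (F.inSet b₀) (F.annSet b₀ (b₀ * M ^ m)) U R ∩
        {ω | ∀ r ∈ R, ∀ r₂ ∈ R, ∃ v ∈ U \ F.inSet b₀, ∃ v' ∈ U \ F.inSet b₀,
          s(v, r) ∈ ω ∧ s(v', r₂) ∈ ω ∧ ω ∈ openConnIn (U \ F.inSet b₀) v v'}}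
    let InP : V → Set V → Set V → Set (BondConfig V) := fun y U R =>
      {ω | ∃ w ∈ R, ∃ v ∈ U, ω ∩ (↑F.E : Set (Sym2 V)) ∈ openConnIn U y v ∧
        s(v, w) ∈ ω ∩ (↑F.E : Set (Sym2 V))}
    let S : ℝ := ∑ d ∈ (Finset.univ : Finset (Finset V × Finset V)),
      P.real (Fd b' UC RC ∩ Fd b ↑d.1 ↑d.2 ∩ openCrossing ((UC ∪ RC) \ ↑d.1) ↑d.2 RC) *
        (P.real (Fd b ↑d.1 ↑d.2 ∩ InP y ↑d.1 ↑d.2) / P.real (Fd b ↑d.1 ↑d.2))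
    S ≤ P.real (Fd b' UC RC ∩ InP y UC RC) ∧
      (1 - (1 - c) ^ (m / 2)) * P.real (Fd b' UC RC ∩ InP y UC RC) ≤ S := by
  intro P Fd InP S
  subst hb'
  classical
  have hq0 : 0 < q := one_pos.trans_le hq
  haveI : IsProbabilityMeasure P := isProbabilityMeasure_rcMeasure G hp hq0 ∅
  have hη0 := F.η_pos
  -- scales
  have hsc1 : b * M ^ m + b ≤ b * M ^ (m + 17 + g) := scale_gap hb hM (by omega)
  have hsc0 : b * M ^ m + b ≤ b * M ^ (m + 1) := scale_gap hb hM (by omega)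
  have hsc0' : b * M ^ (m + 1) + b ≤ b * M ^ (m + 17 + g) := scale_gap hb hM (by omega)
  have hb'0 : 0 < b * M ^ (m + 17 + g) := by positivity
  have hsc2 : b * M ^ (m + 17 + g) + b * M ^ (m + 17 + g) ≤ b * M ^ (m + 17 + g) * M ^ m := by
    have h := scale_gap hb'0 hM (Nat.lt_of_lt_of_le Nat.zero_lt_one hm)
    rw [pow_zero, mul_one] at h
    exact h
  have hsc3 : b * M ^ (m + 17 + g) * M ^ m + b * M ^ (m + 17 + g) ≤ F.Rmax :=
    (scale_gap hb'0 hM (Nat.lt_succ_self m)).trans hRmax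
  have hbm : b ≤ b * M ^ m := by
    have h := scale_gap hb hM (Nat.lt_of_lt_of_le Nat.zero_lt_one hm)
    rw [pow_zero, mul_one] at h
    linarith
  have hRm1 : b * M ^ (m + 1) ≤ F.Rmax := by
    have h1 : b * M ^ (m + 1) ≤ b * M ^ (m + 17 + g) := scale_mono hb hM (by omega)
    have h2 : b * M ^ (m + 17 + g) ≤ b * M ^ (m + 17 + g) * M ^ (m + 1) :=
      le_mul_of_one_le_right hb'0.le (one_le_pow₀ (by linarith))
    linarith
  -- degenerate outer datum: everything vanishes
  by_cases hne : (Fd (b * M ^ (m + 17 + g)) UC RC).Nonempty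
  swap
  · have h0 : Fd (b * M ^ (m + 17 + g)) UC RC = ∅ := Set.not_nonempty_iff_eq_empty.1 hne
    have hS0 : S = 0 := Finset.sum_eq_zero fun d _ => by
      rw [h0, Set.empty_inter, Set.empty_inter, measureReal_empty, zero_mul]
    rw [hS0, h0, Set.empty_inter, measureReal_empty, mul_zero]
    exact ⟨le_rfl, le_rfl⟩
  obtain ⟨ω₀, ⟨hUC, hRC⟩, -⟩ := hne
  -- the outer datum: `U_C ⊇ inSet b'`, rim disjoint from `U_C`
  have hIn'U : F.inSet (b * M ^ (m + 17 + g)) ⊆ UC := hUC ▸ Percolation.subset_explSet _ _ _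
  have hgoodU : ∀ v : V, v ∈ F.good → F.rad v ≤ b * M ^ m + b → v ∈ UC := fun v hg hr =>
    hIn'U ⟨hg, hr.trans hsc1⟩
  have hInU : F.inSet b ⊆ UC := fun v hv => hgoodU v hv.1 (by linarith [hv.2])
  have hBlkU : F.annSet b (b * M ^ m) ⊆ UC := fun v hv => hgoodU v hv.1 (by linarith [hv.2.2])
  have hIBrad : ∀ v ∈ F.inSet b ∪ F.annSet b (b * M ^ m), v ∈ F.good ∧ F.rad v ≤ b * M ^ m := by
    rintro v (⟨hg, h⟩ | ⟨hg, -, h⟩)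
    · exact ⟨hg, h.trans hbm⟩
    · exact ⟨hg, h.le⟩
  have hnbE : ∀ v ∈ F.inSet b ∪ F.annSet b (b * M ^ m), ∀ w : V, s(v, w) ∈ F.E → w ∈ UC := by
    intro v hv w he
    obtain ⟨hvg, hvr⟩ := hIBrad v hv
    obtain ⟨hwg, hwr⟩ := F.adj_good _ he v (Sym2.mem_mk_left v w) w (Sym2.mem_mk_right v w) hvg
      (by linarith)
    have := (abs_lt.1 hwr).2
    exact hgoodU w hwg (by linarith)
  have hnb : ∀ v ∈ F.inSet b ∪ F.annSet b (b * M ^ m), ∀ w : V, G.Adj v w → w ∈ UC := by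
    intro v hv w hvw
    rw [hG, fromEdgeSet_adj] at hvw
    exact hnbE v hv w (Finset.mem_coe.1 hvw.1)
  have hRU : ∀ r ∈ RC, r ∉ UC := fun r hr hrU => by
    rw [← hRC] at hr
    rw [← hUC] at hrU
    exact (Percolation.mem_explRim_iff.1 hr).1 hrU
  -- on an inner datum event: `U_d ⊆ U_C`, `R_d ⊆ U_C`
  have hUDsub : ∀ {ω : BondConfig V} {U' R' : Set V},
      ω ∈ explEvent (F.inSet b) (F.annSet b (b * M ^ m)) U' R' → U' ⊆ UC :=
    fun {ω U' R'} h => h.1 ▸ (Percolation.explSet_subset _ _ ω).trans (Set.union_subset hInU hBlkU)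
  have hRDsub : ∀ {ω : BondConfig V} {U' R' : Set V}, ω ⊆ G.edgeSet →
      ω ∈ explEvent (F.inSet b) (F.annSet b (b * M ^ m)) U' R' → R' ⊆ UC := by
    intro ω U' R' hω h r hr
    rw [← h.2] at hr
    obtain ⟨-, v, hv, hvr⟩ := Percolation.mem_explRim_iff.1 hr
    have he : s(v, r) ∈ F.E := by
      have h' := hω hvr
      rw [hG, edgeSet_fromEdgeSet] at h'
      exact Finset.mem_coe.1 h'.1
    exact hnbE v (Percolation.explSet_subset _ _ ω hv) r he
  -- the events of the chain identity, read on `E(G)`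
  set Eg : Set (Sym2 V) := (↑G.edgeFinset : Set (Sym2 V)) with hEg
  have hEgE : Eg ⊆ ↑F.E := fun e he => by
    have h' : e ∈ G.edgeSet := mem_edgeFinset.1 (Finset.mem_coe.1 he)
    rw [hG, edgeSet_fromEdgeSet] at h'
    exact h'.1
  set Fo' : Set (BondConfig V) := {ω | ω ∩ Eg ∈
    explEvent (F.inSet (b * M ^ (m + 17 + g)))
      (F.annSet (b * M ^ (m + 17 + g)) (b * M ^ (m + 17 + g) * M ^ m)) UC RC ∩
    {ω | ∀ r ∈ RC, ∀ r₂ ∈ RC, ∃ v ∈ UC \ F.inSet (b * M ^ (m + 17 + g)),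
      ∃ v' ∈ UC \ F.inSet (b * M ^ (m + 17 + g)), s(v, r) ∈ ω ∧ s(v', r₂) ∈ ω ∧
        ω ∈ openConnIn (UC \ F.inSet (b * M ^ (m + 17 + g))) v v'}} with hFo'def
  set Fch : Set V → Set V → Set (BondConfig V) := fun U' R' => {ω | ω ∩ Eg ∈
    explEvent (F.inSet b) (F.annSet b (b * M ^ m)) U' R' ∩
      {ω | ∀ r ∈ R', ∀ r₂ ∈ R', ∃ v ∈ U' \ F.inSet b, ∃ v' ∈ U' \ F.inSet b,
        s(v, r) ∈ ω ∧ s(v', r₂) ∈ ω ∧ ω ∈ openConnIn (U' \ F.inSet b) v v'}} with hFchdef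
  set InU : Set (BondConfig V) :=
    {ω | ∃ w ∈ RC, ∃ v ∈ UC, ω ∩ Eg ∈ openConnIn UC y v ∧ s(v, w) ∈ ω ∩ Eg} with hInUdef
  set InU' : Set V → Set V → Set (BondConfig V) := fun U' R' =>
    {ω | ∃ w' ∈ R', ∃ v' ∈ U', ω ∩ Eg ∈ openConnIn U' y v' ∧ s(v', w') ∈ ω ∩ Eg} with hInU'def
  set Mid : Set V → Set V → Set (BondConfig V) := fun U' R' =>
    {ω | ∃ w'' ∈ R', ∃ v ∈ UC, ∃ w ∈ RC, ω ∩ Eg ∈ openConnIn (UC \ U') w'' v ∧ s(v, w) ∈ ω ∩ Eg}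
    with hMiddef
  set NW : Set (BondConfig V) := {ω | ¬ (∀ r ∈ explRim (F.inSet b) (F.annSet b (b * M ^ m)) (ω ∩ Eg),
    ∀ r₂ ∈ explRim (F.inSet b) (F.annSet b (b * M ^ m)) (ω ∩ Eg),
      ∃ v ∈ explSet (F.inSet b) (F.annSet b (b * M ^ m)) (ω ∩ Eg) \ F.inSet b,
        ∃ v' ∈ explSet (F.inSet b) (F.annSet b (b * M ^ m)) (ω ∩ Eg) \ F.inSet b,
          s(v, r) ∈ ω ∩ Eg ∧ s(v', r₂) ∈ ω ∩ Eg ∧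
            ω ∩ Eg ∈ openConnIn (explSet (F.inSet b) (F.annSet b (b * M ^ m)) (ω ∩ Eg) \ F.inSet b)
              v v')} with hNWdef
  set NWE : Set (BondConfig V) :=
    {ω | ¬ ∀ r ∈ explRim (F.inSet b) (F.annSet b (b * M ^ m)) (ω ∩ (↑F.E : Set (Sym2 V))),
      ∀ r₂ ∈ explRim (F.inSet b) (F.annSet b (b * M ^ m)) (ω ∩ (↑F.E : Set (Sym2 V))),
        ∃ v ∈ explSet (F.inSet b) (F.annSet b (b * M ^ m)) (ω ∩ (↑F.E : Set (Sym2 V))) \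
            F.inSet b,
          ∃ v' ∈ explSet (F.inSet b) (F.annSet b (b * M ^ m)) (ω ∩ (↑F.E : Set (Sym2 V))) \
              F.inSet b,
            s(v, r) ∈ ω ∩ (↑F.E : Set (Sym2 V)) ∧ s(v', r₂) ∈ ω ∩ (↑F.E : Set (Sym2 V)) ∧
              ω ∩ (↑F.E : Set (Sym2 V)) ∈ openConnIn
                (explSet (F.inSet b) (F.annSet b (b * M ^ m)) (ω ∩ (↑F.E : Set (Sym2 V))) \
                  F.inSet b) v v'} with hNWEdef
  -- the outer datum event is read on the `E(G)`-edges avoiding the inner block region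
  have hFo'det : ∀ ω₁ ω₂ : BondConfig V,
      (∀ e ∈ G.edgeFinset, (∀ v ∈ e, v ∉ F.inSet b ∧ v ∉ F.annSet b (b * M ^ m)) →
        (e ∈ ω₁ ↔ e ∈ ω₂)) → (ω₁ ∈ Fo' ↔ ω₂ ∈ Fo') := by
    intro ω₁ ω₂ hag
    refine F.datumOff_iff_of_agree_far hb'0 hM hm (hη.trans (by linarith)) (by linarith) hEgE
      fun e he hfar => hag e (Finset.mem_coe.1 he) fun v hv => ?_
    obtain ⟨-, hvr⟩ := hfar v hv
    exact ⟨fun h => by linarith [h.2], fun h => by linarith [h.2.2]⟩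
  have hCH : P.real (Fo' ∩ InU) =
      (∑ d ∈ (Finset.univ : Finset (Finset V × Finset V)),
        P.real (Fch ↑d.1 ↑d.2 ∩ Fo' ∩ Mid ↑d.1 ↑d.2) *
          (P.real (Fch ↑d.1 ↑d.2 ∩ InU' ↑d.1 ↑d.2) / P.real (Fch ↑d.1 ↑d.2))) +
        P.real (Fo' ∩ InU ∩ NW) :=
    insidePiece_eq_sum_add_notWiredOff G hp hq0 (F.inSet b) (F.annSet b (b * M ^ m)) UC RC hInU
      hBlkU hnb hRU y hy Fo' hFo'det
  -- bridges between the `E(G)`-readings and the `E`-readings (they agree on lattice configurations)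
  have e1 : ∀ {ω : BondConfig V}, ω ⊆ G.edgeSet → ω ∩ Eg = ω := fun hω =>
    inter_edgeFinset_eq_self_of_subset_edgeSet G hω
  have e2 : ∀ {ω : BondConfig V}, ω ⊆ G.edgeSet → ω ∩ (↑F.E : Set (Sym2 V)) = ω := fun hω =>
    inter_coe_eq_self_of_subset_edgeSet (hG ▸ hω)
  have bridge : ∀ {A A' : Set (BondConfig V)},
      (∀ ω : BondConfig V, ω ⊆ G.edgeSet → (ω ∈ A ↔ ω ∈ A')) → P.real A = P.real A' :=
    fun h => measureReal_congr (rcMeasure_ae_eq_of_forall_subset_edgeSet G hp hq0 ∅ h)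
  have h_i : P.real (Fo' ∩ InU) = P.real (Fd (b * M ^ (m + 17 + g)) UC RC ∩ InP y UC RC) :=
    bridge fun ω hω => by
      show ω ∈ Fo' ∧ ω ∈ InU ↔ ω ∈ Fd _ UC RC ∧ ω ∈ InP y UC RC
      simp only [hFo'def, hInUdef, Fd, InP, Set.mem_setOf_eq, e1 hω, e2 hω]
  have h_ii : ∀ d : Finset V × Finset V,
      P.real (Fch ↑d.1 ↑d.2 ∩ InU' ↑d.1 ↑d.2) = P.real (Fd b ↑d.1 ↑d.2 ∩ InP y ↑d.1 ↑d.2) :=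
    fun d => bridge fun ω hω => by
      show ω ∈ Fch _ _ ∧ ω ∈ InU' _ _ ↔ ω ∈ Fd b _ _ ∧ ω ∈ InP y _ _
      simp only [hFchdef, hInU'def, Fd, InP, Set.mem_setOf_eq, e1 hω, e2 hω]
  have h_ii' : ∀ d : Finset V × Finset V, P.real (Fch ↑d.1 ↑d.2) = P.real (Fd b ↑d.1 ↑d.2) :=
    fun d => bridge fun ω hω => by
      simp only [hFchdef, Fd, Set.mem_setOf_eq, e1 hω, e2 hω]
  have h_iii : ∀ d : Finset V × Finset V, P.real (Fch ↑d.1 ↑d.2 ∩ Fo' ∩ Mid ↑d.1 ↑d.2) =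
      P.real (Fd (b * M ^ (m + 17 + g)) UC RC ∩ Fd b ↑d.1 ↑d.2 ∩
        openCrossing ((UC ∪ RC) \ ↑d.1) ↑d.2 RC) :=
    fun d => bridge fun ω hω => by
      show (ω ∈ Fch _ _ ∧ ω ∈ Fo') ∧ ω ∈ Mid _ _ ↔ (ω ∈ Fd _ UC RC ∧ ω ∈ Fd b _ _) ∧ ω ∈ _
      simp only [hFchdef, hFo'def, hMiddef, Fd, Set.mem_setOf_eq, e1 hω, e2 hω]
      constructor
      · rintro ⟨⟨hEd, hEC⟩, hM'⟩
        exact ⟨⟨hEC, hEd⟩,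
          (midPiece_iff_openCrossing hEC.1 hEd.1 (hUDsub hEd.1) (hRDsub hω hEd.1)).1 hM'⟩
      · rintro ⟨⟨hEC, hEd⟩, hX⟩
        exact ⟨⟨hEd, hEC⟩,
          (midPiece_iff_openCrossing hEC.1 hEd.1 (hUDsub hEd.1) (hRDsub hω hEd.1)).2 hX⟩
  have h_iv : P.real (Fo' ∩ InU ∩ NW) =
      P.real (Fd (b * M ^ (m + 17 + g)) UC RC ∩ InP y UC RC ∩ NWE) :=
    bridge fun ω hω => by
      show (ω ∈ Fo' ∧ ω ∈ InU) ∧ ω ∈ NW ↔ (ω ∈ Fd _ UC RC ∧ ω ∈ InP y UC RC) ∧ ω ∈ NWE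
      simp only [hFo'def, hInUdef, hNWdef, hNWEdef, Fd, InP, Set.mem_setOf_eq, e1 hω, e2 hω]
  -- the junk bound
  have hFoE : ∀ ω₁ ω₂ : BondConfig V,
      (∀ e ∈ F.E, (∀ x ∈ e, x ∈ F.good → b * M ^ m + F.η ≤ F.rad x) → (e ∈ ω₁ ↔ e ∈ ω₂)) →
        (ω₁ ∈ Fd (b * M ^ (m + 17 + g)) UC RC ↔ ω₂ ∈ Fd (b * M ^ (m + 17 + g)) UC RC) := by
    intro ω₁ ω₂ hag
    refine F.datumOff_iff_of_agree_far hb'0 hM hm (hη.trans (by linarith)) (by linarith)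
      subset_rfl fun e he hfar => hag e (Finset.mem_coe.1 he) fun x hx _ => ?_
    have := (hfar x hx).2
    linarith
  have hJ : P.real (InP y UC RC ∩ Fd (b * M ^ (m + 17 + g)) UC RC ∩ NWE) ≤
      (1 - c) ^ (m / 2) * P.real (InP y UC RC ∩ Fd (b * M ^ (m + 17 + g)) UC RC) :=
    F.inter_notWiredOff_le G hG hp hq hc1 hb hM hRm1 hη hsep (F.isUpperSet_insidePiece y UC RC)
      hFoE
  rw [Set.inter_comm (InP y UC RC)] at hJ
  -- assemble
  have hsum : (∑ d ∈ (Finset.univ : Finset (Finset V × Finset V)),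
      P.real (Fch ↑d.1 ↑d.2 ∩ Fo' ∩ Mid ↑d.1 ↑d.2) *
        (P.real (Fch ↑d.1 ↑d.2 ∩ InU' ↑d.1 ↑d.2) / P.real (Fch ↑d.1 ↑d.2))) = S :=
    Finset.sum_congr rfl fun d _ => by rw [h_iii d, h_ii d, h_ii' d]
  rw [h_i, hsum, h_iv] at hCH
  have hJ0 : 0 ≤ P.real (Fd (b * M ^ (m + 17 + g)) UC RC ∩ InP y UC RC ∩ NWE) :=
    measureReal_nonneg
  constructor
  · linarith
  · nlinarith [hJ, hCH]

end ScaleFrame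

end Literature.Probability.LatticeModels
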